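import Literature.Probability.Percolation.ZdFourArmOutLanded
import Literature.Probability.Percolation.ZdFourArmSepInit
import HarnessLib

/-!
# Outward extension of the outer-landed four-arm event of bond percolation on `ℤ²`, deterministic half

Topic `Literature/Probability/Percolation`; critical bond percolation on `ℤ²`. Proofs and two
auxiliary event definitions (no named fact).

The **extension input of the EXTERNAL half of Kesten's arm-separation scheme** for four alternating
arms (H. Kesten, CMP 109 (1987), §2, Lemma 4; P. Nolin, EJP 13 (2008), §4.3 Prop. 12 (i)
"extendability" and §4.4 p. 12: "going from `∂S_m` to `∂S_{2m}` has a cost `C'₀` depending only on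
`η'₀`"), read on the tree's outer-landed event `zdFourArmOutLanded n M` (`ZdFourArmOutLanded.lean`;
the `H K` of `real_fourArmTwoClusters_le_mul_of_scheme`, `ZdFourArmSeparationStep.lean`): on a
lattice configuration of `zdFourArmOutLanded n M` carrying sixteen corridor crossings at the scales
`M … M'`, `2M ≤ M' ≤ 4M`, the event `zdFourArmOutLanded n M'` holds (`mem_zdFourArmOutLanded_of_mem_outward`).

For the right arm: an open left–right crossing `H` of `[M+1, 2M] × [0, M/64]` meets the old outer
fence `V` (a bottom-to-top crossing of `[M+1, M+M/8] × [z₁ ± M/64]`, `0 ≤ z₁ ≤ M/64`) by the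
crossing lemma; the new body is the old body, the old attaching walk, a piece of `V` and the rest of
`H` up to the column `2M`; the new outer fence at the scale `2M` comes from the three crossings of
`exists_outwardFence_R` (`ZdFourArmSepInit.lean`). The left arm is the mirror image; for the top
dual arm a closed-dual top–bottom face crossing `K` of the face box `[0, M/64] × [M+1, 2M]` meets the
old dual fence `C` (rows `[M+1, M+M/8]`, columns `⊇ [0, M/64]`), the new body is cut sharply at its
first face of the row `2M` (`exists_prefix_reach_ge_sharp`) so that its crossed edges stay in
`A_{n,2M}`, and the new fence comes from `exists_outwardFence_T`; the bottom dual arm is the mirror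
image. The inner extremities are untouched (free).

* `ZdOutOpenArmR/L.outwardTo`, `ZdOutDualArmT/B.outwardTo` — one arm each, from the corridor walks, for a
  target radius `M'` with `2M ≤ M' ≤ 4M` (the corridor reaches the column / row `M'`);
* `outwardOpenEventsTo M M'`, `outwardDualEventsTo M M'` — the sixteen crossing events
  (`outwardOpenEvents M`, `outwardDualEvents M` for `M' = 2M`);
* **`mem_zdFourArmOutLanded_of_mem_outwardTo`** — `zdFourArmOutLanded n M ∩ outwardOpenEventsTo M M' ∩
  outwardDualEventsTo M M' ⊆ zdFourArmOutLanded n M'` on lattice configurations (`64 ≤ M`, `2n ≤ M`,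
  `2M ≤ M' ≤ 4M`), and `mem_zdFourArmOutLanded_of_mem_outward` (`M' = 2M`).

The probabilistic half (generalised FKG, RSW) is `ZdFourArmOutLandedExtProb.lean`.

## References

* P. Nolin, *Near-critical percolation in two dimensions*, EJP 13 (2008), §4.3 Prop. 12 (i), §4.4
  proof of Thm. 11, external extremities (arXiv 0711.4948: Prop. 11 (i), Thm. 10, p. 12) [Nolin2008].
* H. Kesten, *Scaling relations for 2D-percolation*, CMP 109 (1987), §2, Lemma 4, (2.26)–(2.28)
  [KestenScalingCMP1987].
-/

noncomputable section

open Set SimpleGraph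

namespace Literature.Probability.Percolation

open LatticeModels

/-! ### Endpoint bounds for crossed edges -/

/-- Both endpoints of the edge crossed by a step of faces `z → z'` are corners of the face `z`. [folklore] -/
theorem sepEdge_apply_mem_Icc_fst' {z z' v : Site 2} (hadj : (zdGraph 2).Adj z z') (hv : v ∈ sepEdge z z') :
    (z 0 ≤ v 0 ∧ v 0 ≤ z 0 + 1) ∧ (z 1 ≤ v 1 ∧ v 1 ≤ z 1 + 1) := by
  rw [sepEdge_comm] at hv
  exact sepEdge_apply_mem_Icc_snd hadj.symm hv

/-! ### One arm each -/

section Arms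

variable {ω : BondConfig (Site 2)} {n M M' : ℕ}

/-- **Outward extension of the outer-fenced right arm** from `M` to `M'` (`64 ≤ M`, `2n ≤ M`, `2M ≤ M' ≤ 4M`): `H`
an open left–right crossing of `[M+1, M'] × [0, M/64]`, and the three outer crossings of
`exists_outwardFence_R` at the scale `M'`. [cite: Nolin2008, §4.3 Prop. 12 (i) (arXiv 0711.4948: Prop. 11 (i)); KestenScalingCMP1987, §2 Lemma 4] -/
theorem ZdOutOpenArmR.outwardTo (A : ZdOutOpenArmR ω n M 0 (M / 64 : ℕ)) (hM : 64 ≤ M) (h2 : 2 * n ≤ M)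
    (hlo : 2 * M ≤ M') (hhi : M' ≤ 4 * M)
    {s y : Site 2} (H : (zdGraph 2).Walk s y) (hs : s 0 = (M : ℤ) + 1) (hy : y 0 = (M' : ℤ))
    (hH : ∀ v ∈ H.support, (M : ℤ) + 1 ≤ v 0 ∧ v 0 ≤ (M' : ℤ) ∧ 0 ≤ v 1 ∧ v 1 ≤ (M / 64 : ℕ))
    (hHo : ∀ e ∈ H.edges, e ∈ ω)
    {s₂ y₂ : Site 2} (G₀ : (zdGraph 2).Walk s₂ y₂) (hs₂ : s₂ 0 = (M' : ℤ) - (M' / 16 : ℕ))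
    (hy₂ : y₂ 0 + 1 = (M' : ℤ) + (M' / 8 : ℕ))
    (hG₀ : ∀ v ∈ G₀.support, (M' : ℤ) - (M' / 16 : ℕ) ≤ v 0 ∧
      v 0 + 1 ≤ (M' : ℤ) + (M' / 8 : ℕ) ∧ 0 ≤ v 1 ∧ v 1 ≤ (M' / 64 : ℕ))
    (hG₀o : ∀ e ∈ G₀.edges, e ∈ ω)
    {p₂ q₂ : Site 2} (U₀ : (zdGraph 2).Walk p₂ q₂) (hp₂ : p₂ 1 = -((M' / 64 : ℕ) : ℤ))
    (hq₂ : q₂ 1 = 2 * ((M' / 64 : ℕ) : ℤ))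
    (hU₀ : ∀ v ∈ U₀.support, (M' : ℤ) - (M' / 16 : ℕ) ≤ v 0 ∧ v 0 + 1 ≤ (M' : ℤ) ∧
      -((M' / 64 : ℕ) : ℤ) ≤ v 1 ∧ v 1 ≤ 2 * ((M' / 64 : ℕ) : ℤ))
    (hU₀o : ∀ e ∈ U₀.edges, e ∈ ω)
    {p₃ q₃ : Site 2} (U : (zdGraph 2).Walk p₃ q₃) (hp₃ : p₃ 1 = -((M' / 64 : ℕ) : ℤ))
    (hq₃ : q₃ 1 = 2 * ((M' / 64 : ℕ) : ℤ))
    (hU : ∀ v ∈ U.support, (M' : ℤ) + 1 ≤ v 0 ∧ v 0 + 1 ≤ (M' : ℤ) + (M' / 8 : ℕ) ∧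
      -((M' / 64 : ℕ) : ℤ) ≤ v 1 ∧ v 1 ≤ 2 * ((M' / 64 : ℕ) : ℤ))
    (hUo : ∀ e ∈ U.edges, e ∈ ω) :
    Nonempty (ZdOutOpenArmR ω n M' 0 (M' / 64 : ℕ)) := by
  classical
  have hn : 1 ≤ n := one_le_of_mem_siteSphere A.hx
  have hz := A.hz
  have hab := A.hab
  have hV := A.hV
  have hP := A.hP
  have hdiv : M / 64 ≤ M' / 64 := Nat.div_le_div_right (by omega)
  -- `H` up to its first visit to the column `M + M/8` meets the old fence
  obtain ⟨q, T, hq, hTs, hTe⟩ := exists_prefix_reach_ge 0 H ((M : ℤ) + (M / 8 : ℕ)) (by rw [hs]; omega)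
    (by rw [hy]; push_cast; omega)
  obtain ⟨v₁, hv₁T, hv₁V⟩ := exists_mem_support_of_vFence (L := (M : ℤ) + 1) (R := (M : ℤ) + (M / 8 : ℕ))
    (B₀ := 0) (B₁ := ((M / 64 : ℕ) : ℤ)) A.V (fun z hz' => ⟨(hV z hz').1, (hV z hz').2.1⟩)
    (by rw [hab.1]; omega) (by rw [hab.2]; omega) (by omega) T hs hq
    (fun z hz' => by
      obtain ⟨h1, h2⟩ := hTs z hz'
      obtain ⟨a0, -, a1, a1'⟩ := hH z h2
      exact ⟨a0, h1, a1, a1'⟩)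
  have hv₁H : v₁ ∈ H.support := (hTs v₁ hv₁T).2
  have hv₁b := hTs v₁ hv₁T
  obtain ⟨Vp, hVps, hVpe⟩ := exists_walk_within_support A.V A.hu hv₁V
  obtain ⟨Hp, hHps, hHpe⟩ := exists_walk_within_support H hv₁H H.end_mem_support
  have hyb := hH y H.end_mem_support
  -- the tail of `Hp` after its last visit to the column `2M - (2M)/16`
  obtain ⟨qX, Gr, hqX, hGrs, hGre⟩ := exists_prefix_reach_le 0 Hp.reverse
    ((M' : ℤ) - (M' / 16 : ℕ)) (by rw [hy]; omega) (by omega)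
  obtain ⟨a, b, u, V', P', hab', hV', hV'o, hu', hP', hP'o⟩ := exists_outwardFence_R (N := M') (by omega)
    (X := (M' : ℤ) - (M' / 16 : ℕ)) (by omega) Gr.reverse hqX hy
    (fun v hv => by
      rw [Walk.support_reverse, List.mem_reverse] at hv
      obtain ⟨h1, h2⟩ := hGrs v hv
      rw [Walk.support_reverse, List.mem_reverse] at h2
      obtain ⟨a0, a0', a1, a1'⟩ := hH v (hHps v h2)
      exact ⟨h1, a0', a1, by omega⟩)
    (fun e he => by
      rw [Walk.edges_reverse, List.mem_reverse] at he
      have := hGre e he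
      rw [Walk.edges_reverse, List.mem_reverse] at this
      exact hHo e (hHpe e this))
    G₀ hs₂ hy₂ hG₀ hG₀o U₀ hp₂ hq₂ hU₀ hU₀o U hp₃ hq₃ hU hUo
  refine ⟨{
    x := A.x, z := y, W := A.W.append (A.P.append (Vp.append Hp)), hx := A.hx
    hz := ⟨hy, hyb.2.2.1, by omega⟩, hW := fun v hv => ?_, hWo := fun e he => ?_
    a := a, b := b, u := u, V := V', P := P', hab := hab', hV := hV', hVo := hV'o, hu := hu', hP := hP'
    hPo := hP'o }⟩
  · rw [Walk.mem_support_append_iff, Walk.mem_support_append_iff, Walk.mem_support_append_iff] at hv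
    rcases hv with hv | hv | hv | hv
    · exact sqAnnulus_mono le_rfl (by omega) (A.hW v hv)
    · obtain ⟨h0, h1⟩ := hP v hv
      have e0 := abs_le.1 (show |v 0 - A.z 0| ≤ (M / 8 : ℕ) by omega)
      have e1 := abs_le.1 (show |v 1 - A.z 1| ≤ (M / 8 : ℕ) by omega)
      exact mem_sqAnnulus_of_bounds hn (by omega) (by omega) (by omega)
        (by omega) (Or.inl (by omega))
    · obtain ⟨h0, h0', h1⟩ := hV v (hVps v hv)
      have e1 := abs_le.1 h1
      exact mem_sqAnnulus_of_bounds hn (by omega) (by omega) (by omega)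
        (by omega) (Or.inl (by omega))
    · obtain ⟨h0, h0', h1, h1'⟩ := hH v (hHps v hv)
      exact mem_sqAnnulus_of_bounds hn (by omega) (by omega) (by omega)
        (by omega) (Or.inl (by omega))
  · rw [Walk.edges_append, List.mem_append, Walk.edges_append, List.mem_append, Walk.edges_append,
      List.mem_append] at he
    rcases he with he | he | he | he
    · exact A.hWo e he
    · exact A.hPo e he
    · exact A.hVo e (hVpe e he)
    · exact hHo e (hHpe e he)

/-- **Outward extension of the outer-fenced left arm** (mirror image; `H` crosses
`[-2M, -M-1] × [0, M/64]` and is given from its RIGHT column `-M-1`). [cite: Nolin2008, §4.3 Prop. 12 (i) (arXiv 0711.4948: Prop. 11 (i)); KestenScalingCMP1987, §2 Lemma 4] -/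
theorem ZdOutOpenArmL.outwardTo (A : ZdOutOpenArmL ω n M 0 (M / 64 : ℕ)) (hM : 64 ≤ M) (h2 : 2 * n ≤ M)
    (hlo : 2 * M ≤ M') (hhi : M' ≤ 4 * M)
    {s y : Site 2} (H : (zdGraph 2).Walk s y) (hs : s 0 = -(M : ℤ) - 1) (hy : y 0 = -(M' : ℤ))
    (hH : ∀ v ∈ H.support, -(M' : ℤ) ≤ v 0 ∧ v 0 ≤ -(M : ℤ) - 1 ∧ 0 ≤ v 1 ∧ v 1 ≤ (M / 64 : ℕ))
    (hHo : ∀ e ∈ H.edges, e ∈ ω)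
    {s₂ y₂ : Site 2} (G₀ : (zdGraph 2).Walk s₂ y₂) (hs₂ : s₂ 0 = -(M' : ℤ) + (M' / 16 : ℕ))
    (hy₂ : y₂ 0 = -(M' : ℤ) - (M' / 8 : ℕ) + 1)
    (hG₀ : ∀ v ∈ G₀.support, -(M' : ℤ) - (M' / 8 : ℕ) + 1 ≤ v 0 ∧
      v 0 ≤ -(M' : ℤ) + (M' / 16 : ℕ) ∧ 0 ≤ v 1 ∧ v 1 ≤ (M' / 64 : ℕ))
    (hG₀o : ∀ e ∈ G₀.edges, e ∈ ω)
    {p₂ q₂ : Site 2} (U₀ : (zdGraph 2).Walk p₂ q₂) (hp₂ : p₂ 1 = -((M' / 64 : ℕ) : ℤ))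
    (hq₂ : q₂ 1 = 2 * ((M' / 64 : ℕ) : ℤ))
    (hU₀ : ∀ v ∈ U₀.support, -(M' : ℤ) + 1 ≤ v 0 ∧ v 0 ≤ -(M' : ℤ) + (M' / 16 : ℕ) ∧
      -((M' / 64 : ℕ) : ℤ) ≤ v 1 ∧ v 1 ≤ 2 * ((M' / 64 : ℕ) : ℤ))
    (hU₀o : ∀ e ∈ U₀.edges, e ∈ ω)
    {p₃ q₃ : Site 2} (U : (zdGraph 2).Walk p₃ q₃) (hp₃ : p₃ 1 = -((M' / 64 : ℕ) : ℤ))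
    (hq₃ : q₃ 1 = 2 * ((M' / 64 : ℕ) : ℤ))
    (hU : ∀ v ∈ U.support, -(M' : ℤ) - (M' / 8 : ℕ) + 1 ≤ v 0 ∧ v 0 + 1 ≤ -(M' : ℤ) ∧
      -((M' / 64 : ℕ) : ℤ) ≤ v 1 ∧ v 1 ≤ 2 * ((M' / 64 : ℕ) : ℤ))
    (hUo : ∀ e ∈ U.edges, e ∈ ω) :
    Nonempty (ZdOutOpenArmL ω n M' 0 (M' / 64 : ℕ)) := by
  classical
  have hn : 1 ≤ n := one_le_of_mem_siteSphere A.hx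
  have hz := A.hz
  have hab := A.hab
  have hV := A.hV
  have hP := A.hP
  have hdiv : M / 64 ≤ M' / 64 := Nat.div_le_div_right (by omega)
  -- `H` up to its first visit to the column `-M - M/8` meets the old fence
  obtain ⟨q, T, hq, hTs, hTe⟩ := exists_prefix_reach_le 0 H (-(M : ℤ) - (M / 8 : ℕ)) (by rw [hs]; omega)
    (by rw [hy]; push_cast; omega)
  obtain ⟨v₁, hv₁T, hv₁V⟩ := exists_mem_support_of_vFence (L := -(M : ℤ) - (M / 8 : ℕ)) (R := -(M : ℤ) - 1)
    (B₀ := 0) (B₁ := ((M / 64 : ℕ) : ℤ)) A.V (fun z hz' => ⟨by have := (hV z hz').1; omega, by have := (hV z hz').2.1; omega⟩)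
    (by rw [hab.1]; omega) (by rw [hab.2]; omega) (by omega) T.reverse (by simpa using hq) (by simpa using hs)
    (fun z hz' => by
      rw [Walk.support_reverse, List.mem_reverse] at hz'
      obtain ⟨h1, h2⟩ := hTs z hz'
      obtain ⟨-, a0', a1, a1'⟩ := hH z h2
      exact ⟨h1, a0', a1, a1'⟩)
  rw [Walk.support_reverse, List.mem_reverse] at hv₁T
  have hv₁H : v₁ ∈ H.support := (hTs v₁ hv₁T).2
  have hv₁b := hTs v₁ hv₁T
  obtain ⟨Vp, hVps, hVpe⟩ := exists_walk_within_support A.V A.hu hv₁V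
  obtain ⟨Hp, hHps, hHpe⟩ := exists_walk_within_support H hv₁H H.end_mem_support
  have hyb := hH y H.end_mem_support
  -- the tail of `Hp` after its last visit to the column `-2M + (2M)/16`
  obtain ⟨qX, Gr, hqX, hGrs, hGre⟩ := exists_prefix_reach_ge 0 Hp.reverse
    (-(M' : ℤ) + (M' / 16 : ℕ)) (by rw [hy]; omega) (by omega)
  obtain ⟨a, b, u, V', P', hab', hV', hV'o, hu', hP', hP'o⟩ := exists_outwardFence_L (N := M') (by omega)
    (X := -(M' : ℤ) + (M' / 16 : ℕ)) (by omega) Gr.reverse hqX hy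
    (fun v hv => by
      rw [Walk.support_reverse, List.mem_reverse] at hv
      obtain ⟨h1, h2⟩ := hGrs v hv
      rw [Walk.support_reverse, List.mem_reverse] at h2
      obtain ⟨a0, a0', a1, a1'⟩ := hH v (hHps v h2)
      exact ⟨a0, h1, a1, by omega⟩)
    (fun e he => by
      rw [Walk.edges_reverse, List.mem_reverse] at he
      have := hGre e he
      rw [Walk.edges_reverse, List.mem_reverse] at this
      exact hHo e (hHpe e this))
    G₀ hs₂ hy₂ hG₀ hG₀o U₀ hp₂ hq₂ hU₀ hU₀o U hp₃ hq₃ hU hUo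
  refine ⟨{
    x := A.x, z := y, W := A.W.append (A.P.append (Vp.append Hp)), hx := A.hx
    hz := ⟨hy, hyb.2.2.1, by omega⟩, hW := fun v hv => ?_, hWo := fun e he => ?_
    a := a, b := b, u := u, V := V', P := P', hab := hab', hV := hV', hVo := hV'o, hu := hu', hP := hP'
    hPo := hP'o }⟩
  · rw [Walk.mem_support_append_iff, Walk.mem_support_append_iff, Walk.mem_support_append_iff] at hv
    rcases hv with hv | hv | hv | hv
    · exact sqAnnulus_mono le_rfl (by omega) (A.hW v hv)
    · obtain ⟨h0, h1⟩ := hP v hv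
      have e0 := abs_le.1 (show |v 0 - A.z 0| ≤ (M / 8 : ℕ) by omega)
      have e1 := abs_le.1 (show |v 1 - A.z 1| ≤ (M / 8 : ℕ) by omega)
      exact mem_sqAnnulus_of_bounds hn (by omega) (by omega) (by omega)
        (by omega) (Or.inr (Or.inl (by omega)))
    · obtain ⟨h0, h0', h1⟩ := hV v (hVps v hv)
      have e1 := abs_le.1 h1
      exact mem_sqAnnulus_of_bounds hn (by omega) (by omega) (by omega)
        (by omega) (Or.inr (Or.inl (by omega)))
    · obtain ⟨h0, h0', h1, h1'⟩ := hH v (hHps v hv)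
      exact mem_sqAnnulus_of_bounds hn (by omega) (by omega) (by omega)
        (by omega) (Or.inr (Or.inl (by omega)))
  · rw [Walk.edges_append, List.mem_append, Walk.edges_append, List.mem_append, Walk.edges_append,
      List.mem_append] at he
    rcases he with he | he | he | he
    · exact A.hWo e he
    · exact A.hPo e he
    · exact A.hVo e (hVpe e he)
    · exact hHo e (hHpe e he)

/-- **Outward extension of the outer-fenced top dual arm** from `M` to `M'` (`64 ≤ M`, `2n ≤ M`, `2M ≤ M' ≤ 4M`):
`K` a closed-dual walk of faces of the face box `[0, M/64] × [M+1, 2M]` from its top row to its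
bottom row, and the three outer face crossings of `exists_outwardFence_T` at the scale `2M`; the new
body is cut at its first face of the row `2M`. [cite: Nolin2008, §4.3 Prop. 12 (i) (arXiv 0711.4948: Prop. 11 (i)); KestenScalingCMP1987, §2 Lemma 4] -/
theorem ZdOutDualArmT.outwardTo (D : ZdOutDualArmT ω n M 0 (M / 64 : ℕ)) (hM : 64 ≤ M) (h2 : 2 * n ≤ M)
    (hlo : 2 * M ≤ M') (hhi : M' ≤ 4 * M)
    {ka kb : Site 2} (K : (zdGraph 2).Walk ka kb) (hka : ka 1 = (M' : ℤ)) (hkb : kb 1 = (M : ℤ) + 1)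
    (hK : ∀ f ∈ K.support, 0 ≤ f 0 ∧ f 0 ≤ (M / 64 : ℕ) ∧ (M : ℤ) + 1 ≤ f 1 ∧ f 1 ≤ (M' : ℤ))
    (hKc : ∀ d ∈ K.darts, sepEdge d.fst d.snd ∉ ω)
    {xa xb : Site 2} (Hd : (zdGraph 2).Walk xa xb) (hxa : xa 0 = -((M' / 64 : ℕ) : ℤ))
    (hxb : xb 0 = 2 * ((M' / 64 : ℕ) : ℤ))
    (hHd : ∀ f ∈ Hd.support, -((M' / 64 : ℕ) : ℤ) ≤ f 0 ∧ f 0 ≤ 2 * ((M' / 64 : ℕ) : ℤ) ∧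
      (M' : ℤ) - (M' / 16 : ℕ) + 1 ≤ f 1 ∧ f 1 + 1 ≤ (M' : ℤ))
    (hHdc : ∀ d ∈ Hd.darts, sepEdge d.fst d.snd ∉ ω)
    {va vb : Site 2} (Vd : (zdGraph 2).Walk va vb) (hva : va 1 + 1 = (M' : ℤ) + (M' / 8 : ℕ))
    (hvb : vb 1 = (M' : ℤ) - (M' / 16 : ℕ) + 1)
    (hVd : ∀ f ∈ Vd.support, 0 ≤ f 0 ∧ f 0 ≤ (M' / 64 : ℕ) ∧
      (M' : ℤ) - (M' / 16 : ℕ) + 1 ≤ f 1 ∧ f 1 + 1 ≤ (M' : ℤ) + (M' / 8 : ℕ))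
    (hVdc : ∀ d ∈ Vd.darts, sepEdge d.fst d.snd ∉ ω)
    {ya yb : Site 2} (Cd : (zdGraph 2).Walk ya yb) (hya : ya 0 = -((M' / 64 : ℕ) : ℤ))
    (hyb : yb 0 = 2 * ((M' / 64 : ℕ) : ℤ))
    (hCd : ∀ f ∈ Cd.support, -((M' / 64 : ℕ) : ℤ) ≤ f 0 ∧ f 0 ≤ 2 * ((M' / 64 : ℕ) : ℤ) ∧
      (M' : ℤ) + 1 ≤ f 1 ∧ f 1 + 1 ≤ (M' : ℤ) + (M' / 8 : ℕ))
    (hCdc : ∀ d ∈ Cd.darts, sepEdge d.fst d.snd ∉ ω) :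
    Nonempty (ZdOutDualArmT ω n M' 0 (M' / 64 : ℕ)) := by
  classical
  have hn2 : (n : ℤ) ≤ (M : ℤ) - (M / 8 : ℕ) := by omega
  have hf := D.hf
  have hg := D.hg
  have hab := D.hab
  have hC := D.hC
  have hP := D.hP
  have hdiv : M / 64 ≤ M' / 64 := Nat.div_le_div_right (by omega)
  -- a segment of `K` across the rows `[M+1, M+M/8]` meets the old fence `C`
  obtain ⟨p, q', S, hp, hq', hSs, -⟩ := exists_segment_between 1 K.reverse ((M : ℤ) + 1) ((M : ℤ) + (M / 8 : ℕ))
    (by rw [hkb]) (by rw [hka]; push_cast; omega) (by omega)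
  obtain ⟨v₂, hv₂S, hv₂C⟩ := exists_mem_support_of_hFence (L₀ := 0) (L₁ := ((M / 64 : ℕ) : ℤ))
    (B := (M : ℤ) + 1) (B' := (M : ℤ) + (M / 8 : ℕ)) D.C (fun z hz => ⟨(hC z hz).2.1, (hC z hz).2.2⟩)
    (by rw [hab.1]; omega) (by rw [hab.2]; omega) (by omega) S hp hq'
    (fun z hz => by
      obtain ⟨h1, h1', h2⟩ := hSs z hz
      rw [Walk.support_reverse, List.mem_reverse] at h2
      obtain ⟨a0, a0', -, -⟩ := hK z h2
      exact ⟨a0, a0', h1, h1'⟩)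
  have hv₂K : v₂ ∈ K.support := by
    have := (hSs v₂ hv₂S).2.2
    rwa [Walk.support_reverse, List.mem_reverse] at this
  have hv₂b := hSs v₂ hv₂S
  obtain ⟨Cp, hCps, hCpe⟩ := exists_walk_within_support D.C D.hu hv₂C
  have hCpc : ∀ d ∈ Cp.darts, sepEdge d.fst d.snd ∉ ω := forall_darts_sepEdge_notMem_of_edges D.C D.hCc Cp hCpe
  obtain ⟨Kq, hKqs, hKqe⟩ := exists_walk_within_support K hv₂K K.start_mem_support
  -- sharp cut at the first face of the row `2M`
  obtain ⟨g', Kp, hg', hKps, hKpe, hKpd⟩ := exists_prefix_reach_ge_sharp 1 Kq ((M' : ℤ)) (by omega)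
    (by rw [hka])
  have hKpK : ∀ z ∈ Kp.support, z ∈ K.support := fun z hz => hKqs z (hKps z hz).2
  have hKpc : ∀ d ∈ Kp.darts, sepEdge d.fst d.snd ∉ ω :=
    forall_darts_sepEdge_notMem_of_edges K hKc Kp (fun e he => hKqe e (hKpe e he))
  have hg'b := hK g' (hKpK g' Kp.end_mem_support)
  -- the new outer fence at the scale `2M`
  obtain ⟨qY, Gr, hqY, hGrs, hGre⟩ := exists_prefix_reach_le 1 Kp.reverse
    ((M' : ℤ) - (M' / 16 : ℕ)) (by rw [hg']; omega) (by omega)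
  have hGrc : ∀ d ∈ Gr.reverse.darts, sepEdge d.fst d.snd ∉ ω := by
    refine forall_darts_reverse_sepEdge_notMem Gr
      (forall_darts_sepEdge_notMem_of_edges Kp.reverse (forall_darts_reverse_sepEdge_notMem Kp hKpc) Gr hGre)
  obtain ⟨a, b, u, C', P', hab', hC', hC'c, hu', hP', hP'c⟩ := exists_outwardFence_T (N := M') (by omega)
    (Y := (M' : ℤ) - (M' / 16 : ℕ)) (E := ((M / 64 : ℕ) : ℤ)) (by omega) ⟨by omega, by omega⟩
    Gr.reverse hqY hg'
    (fun f hf' => by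
      rw [Walk.support_reverse, List.mem_reverse] at hf'
      obtain ⟨h1, h2⟩ := hGrs f hf'
      rw [Walk.support_reverse, List.mem_reverse] at h2
      obtain ⟨a0, a0', -, a1'⟩ := hK f (hKpK f h2)
      exact ⟨a0, a0', h1, a1'⟩)
    hGrc Hd hxa hxb hHd hHdc Vd hva hvb hVd hVdc Cd hya hyb hCd hCdc
  refine ⟨{
    f := D.f, g := g', Q := D.Q.append (D.P.append (Cp.append Kp)), hf := D.hf
    hg := ⟨hg', hg'b.1, by omega⟩, hQc := fun d hd => ?_, hQa := fun d hd v hv => ?_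
    a := a, b := b, u := u, C := C', P := P', hab := hab', hC := hC', hCc := hC'c, hu := hu', hP := hP'
    hPc := hP'c }⟩
  · rw [Walk.darts_append, List.mem_append, Walk.darts_append, List.mem_append, Walk.darts_append,
      List.mem_append] at hd
    rcases hd with hd | hd | hd | hd
    · exact D.hQc d hd
    · exact D.hPc d hd
    · exact hCpc d hd
    · exact hKpc d hd
  · have hn : 1 ≤ n ∨ n = 0 := by omega
    rw [Walk.darts_append, List.mem_append, Walk.darts_append, List.mem_append, Walk.darts_append,
      List.mem_append] at hd
    rcases hd with hd | hd | hd | hd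
    · exact sqAnnulus_mono le_rfl (by omega) (D.hQa d hd v hv)
    · obtain ⟨⟨c0, c0'⟩, ⟨c1, c1'⟩⟩ := sepEdge_apply_mem_Icc_fst' d.adj hv
      obtain ⟨a0, a1⟩ := hP _ (D.P.dart_fst_mem_support_of_mem_darts hd)
      have ea0 := abs_le.1 (show |d.fst 0 - D.g 0| ≤ (M / 8 : ℕ) by omega)
      have ea1 := abs_le.1 (show |d.fst 1 - D.g 1| ≤ (M / 8 : ℕ) - 1 by omega)
      rcases hn with hn | rfl
      · exact mem_sqAnnulus_of_bounds hn (by omega) (by omega) (by omega)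
          (by omega) (Or.inr (Or.inr (Or.inl (by omega))))
      · simp only [sqAnnulus, Finset.mem_coe, mem_annulus, mem_box, Fin.forall_fin_two]
        exact ⟨⟨⟨by omega, by omega⟩, ⟨by omega, by omega⟩⟩,
          fun h => by have := h.2.2; omega⟩
    · obtain ⟨⟨c0, c0'⟩, ⟨c1, c1'⟩⟩ := sepEdge_apply_mem_Icc_fst' d.adj hv
      obtain ⟨a0, a1, a1'⟩ := hC _ (hCps _ (Cp.dart_fst_mem_support_of_mem_darts hd))
      have ea0 := abs_le.1 a0
      rcases hn with hn | rfl
      · exact mem_sqAnnulus_of_bounds hn (by omega) (by omega) (by omega)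
          (by omega) (Or.inr (Or.inr (Or.inl (by omega))))
      · simp only [sqAnnulus, Finset.mem_coe, mem_annulus, mem_box, Fin.forall_fin_two]
        exact ⟨⟨⟨by omega, by omega⟩, ⟨by omega, by omega⟩⟩,
          fun h => by have := h.2.2; omega⟩
    · obtain ⟨⟨c0, c0'⟩, ⟨c1, c1'⟩⟩ := sepEdge_apply_mem_Icc_fst' d.adj hv
      obtain ⟨a0, a0', a1, a1'⟩ := hK _ (hKpK _ (Kp.dart_fst_mem_support_of_mem_darts hd))
      obtain ⟨-, -, b1, -⟩ := hK _ (hKpK _ (Kp.dart_snd_mem_support_of_mem_darts hd))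
      have hlt := hKpd d hd
      obtain ⟨⟨-, -⟩, ⟨e1, -⟩⟩ := sepEdge_apply_mem_Icc_snd d.adj hv
      rcases hn with hn | rfl
      · exact mem_sqAnnulus_of_bounds hn (by omega) (by omega) (by omega)
          (by omega) (Or.inr (Or.inr (Or.inl (by omega))))
      · simp only [sqAnnulus, Finset.mem_coe, mem_annulus, mem_box, Fin.forall_fin_two]
        exact ⟨⟨⟨by omega, by omega⟩, ⟨by omega, by omega⟩⟩,
          fun h => by have := h.2.2; omega⟩

/-- **Outward extension of the outer-fenced bottom dual arm** (mirror image; `K` runs in the face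
box `[0, M/64] × [-2M-1, -M-2]` from its top row down to its bottom row). [cite: Nolin2008, §4.3 Prop. 12 (i) (arXiv 0711.4948: Prop. 11 (i)); KestenScalingCMP1987, §2 Lemma 4] -/
theorem ZdOutDualArmB.outwardTo (D : ZdOutDualArmB ω n M 0 (M / 64 : ℕ)) (hM : 64 ≤ M) (h2 : 2 * n ≤ M)
    (hlo : 2 * M ≤ M') (hhi : M' ≤ 4 * M)
    {ka kb : Site 2} (K : (zdGraph 2).Walk ka kb) (hka : ka 1 + 2 = -(M : ℤ)) (hkb : kb 1 + 1 = -(M' : ℤ))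
    (hK : ∀ f ∈ K.support, 0 ≤ f 0 ∧ f 0 ≤ (M / 64 : ℕ) ∧ -(M' : ℤ) - 1 ≤ f 1 ∧ f 1 + 2 ≤ -(M : ℤ))
    (hKc : ∀ d ∈ K.darts, sepEdge d.fst d.snd ∉ ω)
    {xa xb : Site 2} (Hd : (zdGraph 2).Walk xa xb) (hxa : xa 0 = -((M' / 64 : ℕ) : ℤ))
    (hxb : xb 0 = 2 * ((M' / 64 : ℕ) : ℤ))
    (hHd : ∀ f ∈ Hd.support, -((M' / 64 : ℕ) : ℤ) ≤ f 0 ∧ f 0 ≤ 2 * ((M' / 64 : ℕ) : ℤ) ∧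
      -(M' : ℤ) ≤ f 1 ∧ f 1 + 2 ≤ -(M' : ℤ) + (M' / 16 : ℕ))
    (hHdc : ∀ d ∈ Hd.darts, sepEdge d.fst d.snd ∉ ω)
    {va vb : Site 2} (Vd : (zdGraph 2).Walk va vb) (hva : va 1 + 2 = -(M' : ℤ) + (M' / 16 : ℕ))
    (hvb : vb 1 = -(M' : ℤ) - (M' / 8 : ℕ))
    (hVd : ∀ f ∈ Vd.support, 0 ≤ f 0 ∧ f 0 ≤ (M' / 64 : ℕ) ∧ -(M' : ℤ) - (M' / 8 : ℕ) ≤ f 1 ∧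
      f 1 + 2 ≤ -(M' : ℤ) + (M' / 16 : ℕ))
    (hVdc : ∀ d ∈ Vd.darts, sepEdge d.fst d.snd ∉ ω)
    {ya yb : Site 2} (Cd : (zdGraph 2).Walk ya yb) (hya : ya 0 = -((M' / 64 : ℕ) : ℤ))
    (hyb : yb 0 = 2 * ((M' / 64 : ℕ) : ℤ))
    (hCd : ∀ f ∈ Cd.support, -((M' / 64 : ℕ) : ℤ) ≤ f 0 ∧ f 0 ≤ 2 * ((M' / 64 : ℕ) : ℤ) ∧
      -(M' : ℤ) - (M' / 8 : ℕ) ≤ f 1 ∧ f 1 + 2 ≤ -(M' : ℤ))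
    (hCdc : ∀ d ∈ Cd.darts, sepEdge d.fst d.snd ∉ ω) :
    Nonempty (ZdOutDualArmB ω n M' 0 (M' / 64 : ℕ)) := by
  classical
  have hf := D.hf
  have hg := D.hg
  have hab := D.hab
  have hC := D.hC
  have hP := D.hP
  have hdiv : M / 64 ≤ M' / 64 := Nat.div_le_div_right (by omega)
  -- a segment of `K` (reversed, going up) across the rows `[-M-1-M/8, -M-2]` meets the old fence `C`
  obtain ⟨p, q', S, hp, hq', hSs, -⟩ := exists_segment_between 1 K.reverse (-(M : ℤ) - 1 - (M / 8 : ℕ)) (-(M : ℤ) - 2)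
    (by omega) (by omega) (by omega)
  obtain ⟨v₂, hv₂S, hv₂C⟩ := exists_mem_support_of_hFence (L₀ := 0) (L₁ := ((M / 64 : ℕ) : ℤ))
    (B := -(M : ℤ) - 1 - (M / 8 : ℕ)) (B' := -(M : ℤ) - 2) D.C
    (fun z hz => ⟨by have := (hC z hz).2.1; omega, by have := (hC z hz).2.2; omega⟩)
    (by rw [hab.1]; omega) (by rw [hab.2]; omega) (by omega) S hp hq'
    (fun z hz => by
      obtain ⟨h1, h1', h2⟩ := hSs z hz
      rw [Walk.support_reverse, List.mem_reverse] at h2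
      obtain ⟨a0, a0', -, -⟩ := hK z h2
      exact ⟨a0, a0', h1, h1'⟩)
  have hv₂K : v₂ ∈ K.support := by
    have := (hSs v₂ hv₂S).2.2
    rwa [Walk.support_reverse, List.mem_reverse] at this
  have hv₂b := hSs v₂ hv₂S
  obtain ⟨Cp, hCps, hCpe⟩ := exists_walk_within_support D.C D.hu hv₂C
  have hCpc : ∀ d ∈ Cp.darts, sepEdge d.fst d.snd ∉ ω := forall_darts_sepEdge_notMem_of_edges D.C D.hCc Cp hCpe
  obtain ⟨Kq, hKqs, hKqe⟩ := exists_walk_within_support K hv₂K K.end_mem_support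
  -- sharp cut at the first face of the row `-2M-1`
  obtain ⟨g', Kp, hg', hKps, hKpe, hKpd⟩ := exists_prefix_reach_le_sharp 1 Kq (-(M' : ℤ) - 1) (by omega)
    (by omega)
  have hKpK : ∀ z ∈ Kp.support, z ∈ K.support := fun z hz => hKqs z (hKps z hz).2
  have hKpc : ∀ d ∈ Kp.darts, sepEdge d.fst d.snd ∉ ω :=
    forall_darts_sepEdge_notMem_of_edges K hKc Kp (fun e he => hKqe e (hKpe e he))
  have hg'b := hK g' (hKpK g' Kp.end_mem_support)
  -- the new outer fence at the scale `2M`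
  obtain ⟨qY, Gr, hqY, hGrs, hGre⟩ := exists_prefix_reach_ge 1 Kp.reverse
    (-(M' : ℤ) + (M' / 16 : ℕ) - 2) (by rw [hg']; omega) (by omega)
  have hGrc : ∀ d ∈ Gr.reverse.darts, sepEdge d.fst d.snd ∉ ω := by
    refine forall_darts_reverse_sepEdge_notMem Gr
      (forall_darts_sepEdge_notMem_of_edges Kp.reverse (forall_darts_reverse_sepEdge_notMem Kp hKpc) Gr hGre)
  obtain ⟨a, b, u, C', P', hab', hC', hC'c, hu', hP', hP'c⟩ := exists_outwardFence_B (N := M') (by omega)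
    (Y := -(M' : ℤ) + (M' / 16 : ℕ) - 2) (E := ((M / 64 : ℕ) : ℤ)) (by omega) ⟨by omega, by omega⟩
    Gr.reverse hqY (by omega)
    (fun f hf' => by
      rw [Walk.support_reverse, List.mem_reverse] at hf'
      obtain ⟨h1, h2⟩ := hGrs f hf'
      rw [Walk.support_reverse, List.mem_reverse] at h2
      obtain ⟨a0, a0', a1, -⟩ := hK f (hKpK f h2)
      exact ⟨a0, a0', a1, h1⟩)
    hGrc Hd hxa hxb hHd hHdc Vd hva hvb hVd hVdc Cd hya hyb hCd hCdc
  refine ⟨{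
    f := D.f, g := g', Q := D.Q.append (D.P.append (Cp.append Kp)), hf := D.hf
    hg := ⟨by omega, hg'b.1, by omega⟩, hQc := fun d hd => ?_, hQa := fun d hd v hv => ?_
    a := a, b := b, u := u, C := C', P := P', hab := hab', hC := hC', hCc := hC'c, hu := hu', hP := hP'
    hPc := hP'c }⟩
  · rw [Walk.darts_append, List.mem_append, Walk.darts_append, List.mem_append, Walk.darts_append,
      List.mem_append] at hd
    rcases hd with hd | hd | hd | hd
    · exact D.hQc d hd
    · exact D.hPc d hd
    · exact hCpc d hd
    · exact hKpc d hd
  · have hn : 1 ≤ n ∨ n = 0 := by omega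
    rw [Walk.darts_append, List.mem_append, Walk.darts_append, List.mem_append, Walk.darts_append,
      List.mem_append] at hd
    rcases hd with hd | hd | hd | hd
    · exact sqAnnulus_mono le_rfl (by omega) (D.hQa d hd v hv)
    · obtain ⟨⟨c0, c0'⟩, ⟨c1, c1'⟩⟩ := sepEdge_apply_mem_Icc_fst' d.adj hv
      obtain ⟨a0, a1⟩ := hP _ (D.P.dart_fst_mem_support_of_mem_darts hd)
      have ea0 := abs_le.1 (show |d.fst 0 - D.g 0| ≤ (M / 8 : ℕ) by omega)
      have ea1 := abs_le.1 (show |d.fst 1 - D.g 1| ≤ (M / 8 : ℕ) - 1 by omega)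
      rcases hn with hn | rfl
      · exact mem_sqAnnulus_of_bounds hn (by omega) (by omega) (by omega)
          (by omega) (Or.inr (Or.inr (Or.inr (by omega))))
      · simp only [sqAnnulus, Finset.mem_coe, mem_annulus, mem_box, Fin.forall_fin_two]
        exact ⟨⟨⟨by omega, by omega⟩, ⟨by omega, by omega⟩⟩,
          fun h => by have := h.2.1; omega⟩
    · obtain ⟨⟨c0, c0'⟩, ⟨c1, c1'⟩⟩ := sepEdge_apply_mem_Icc_fst' d.adj hv
      obtain ⟨a0, a1, a1'⟩ := hC _ (hCps _ (Cp.dart_fst_mem_support_of_mem_darts hd))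
      have ea0 := abs_le.1 a0
      rcases hn with hn | rfl
      · exact mem_sqAnnulus_of_bounds hn (by omega) (by omega) (by omega)
          (by omega) (Or.inr (Or.inr (Or.inr (by omega))))
      · simp only [sqAnnulus, Finset.mem_coe, mem_annulus, mem_box, Fin.forall_fin_two]
        exact ⟨⟨⟨by omega, by omega⟩, ⟨by omega, by omega⟩⟩,
          fun h => by have := h.2.1; omega⟩
    · obtain ⟨⟨c0, c0'⟩, ⟨c1, c1'⟩⟩ := sepEdge_apply_mem_Icc_fst' d.adj hv
      obtain ⟨a0, a0', a1, a1'⟩ := hK _ (hKpK _ (Kp.dart_fst_mem_support_of_mem_darts hd))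
      have hlt := hKpd d hd
      rcases hn with hn | rfl
      · exact mem_sqAnnulus_of_bounds hn (by omega) (by omega) (by omega)
          (by omega) (Or.inr (Or.inr (Or.inr (by omega))))
      · simp only [sqAnnulus, Finset.mem_coe, mem_annulus, mem_box, Fin.forall_fin_two]
        exact ⟨⟨⟨by omega, by omega⟩, ⟨by omega, by omega⟩⟩,
          fun h => by have := h.2.1; omega⟩

end Arms

/-! ### The sixteen events and the inclusion -/

section Events

/-- **The eight open events** of the outward extension from `M` to `2M`: for the right arm the
corridor `[M+1, 2M] × [0, M/64]` (left–right) and the three outer crossings of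
`exists_outwardFence_R` at the scale `2M`; mirror images for the left arm. [cite: Nolin2008, §4.3 Prop. 12 (i) (arXiv 0711.4948: Prop. 11 (i))] -/
def outwardOpenEventsTo (M M' : ℕ) : Set (BondConfig (Site 2)) :=
  (lrCrossingAt ![(M : ℤ) + 1, 0] (M' - M - 1) (M / 64) ∩
    (lrCrossingAt ![(M' : ℤ) - (M' / 16 : ℕ), 0] (M' / 16 + M' / 8 - 1) (M' / 64) ∩
      (tbCrossingAt' ![(M' : ℤ) - (M' / 16 : ℕ), -((M' / 64 : ℕ) : ℤ)] (M' / 16 - 1)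
          (3 * (M' / 64)) ∩
        tbCrossingAt' ![(M' : ℤ) + 1, -((M' / 64 : ℕ) : ℤ)] (M' / 8 - 2) (3 * (M' / 64))))) ∩
  (lrCrossingAt ![-(M' : ℤ), 0] (M' - M - 1) (M / 64) ∩
    (lrCrossingAt ![-(M' : ℤ) - (M' / 8 : ℕ) + 1, 0] (M' / 16 + M' / 8 - 1) (M' / 64) ∩
      (tbCrossingAt' ![-(M' : ℤ) + 1, -((M' / 64 : ℕ) : ℤ)] (M' / 16 - 1) (3 * (M' / 64)) ∩
        tbCrossingAt' ![-(M' : ℤ) - (M' / 8 : ℕ) + 1, -((M' / 64 : ℕ) : ℤ)] (M' / 8 - 2)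
          (3 * (M' / 64)))))

/-- **The eight closed-dual events** of the outward extension: for the top dual arm the face corridor
`[0, M/64] × [M+1, 2M]` (top–bottom) and the three outer face crossings of `exists_outwardFence_T` at
the scale `2M`; mirror images for the bottom dual arm. [cite: Nolin2008, §4.3 Prop. 12 (i) (arXiv 0711.4948: Prop. 11 (i))] -/
def outwardDualEventsTo (M M' : ℕ) : Set (BondConfig (Site 2)) :=
  (dualFaceCrossing ![0, (M : ℤ) + 2] (M / 64 + 1) (M' - M - 2) ∩
    (dualLRFaceCrossing ![-((M' / 64 : ℕ) : ℤ), (M' : ℤ) - (M' / 16 : ℕ) + 1] (3 * (M' / 64))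
        (M' / 16 - 2) ∩
      (dualFaceCrossing ![0, (M' : ℤ) - (M' / 16 : ℕ) + 2] (M' / 64 + 1)
          (M' / 16 + M' / 8 - 3) ∩
        dualLRFaceCrossing ![-((M' / 64 : ℕ) : ℤ), (M' : ℤ) + 1] (3 * (M' / 64)) (M' / 8 - 2)))) ∩
  (dualFaceCrossing ![0, -(M' : ℤ)] (M / 64 + 1) (M' - M - 2) ∩
    (dualLRFaceCrossing ![-((M' / 64 : ℕ) : ℤ), -(M' : ℤ)] (3 * (M' / 64)) (M' / 16 - 2) ∩
      (dualFaceCrossing ![0, -(M' : ℤ) - (M' / 8 : ℕ) + 1] (M' / 64 + 1)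
          (M' / 16 + M' / 8 - 3) ∩
        dualLRFaceCrossing ![-((M' / 64 : ℕ) : ℤ), -(M' : ℤ) - (M' / 8 : ℕ)] (3 * (M' / 64))
          (M' / 8 - 2))))

variable {ω : BondConfig (Site 2)} {n M M' : ℕ}

/-- **Outward extension, deterministic half**: on a lattice configuration,
`zdFourArmOutLanded n M ∩ outwardOpenEvents M ∩ outwardDualEvents M ⊆ zdFourArmOutLanded n (2M)`
(`64 ≤ M`, `2n ≤ M`). [cite: Nolin2008, §4.3 Prop. 12 (i) and §4.4 proof of Thm. 11 (arXiv 0711.4948: Prop. 11 (i); Thm. 10, p. 12)] [cite: KestenScalingCMP1987, §2 Lemma 4] -/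
theorem mem_zdFourArmOutLanded_of_mem_outwardTo (hω : ω ⊆ (zdGraph 2).edgeSet) (hM : 64 ≤ M) (h2 : 2 * n ≤ M)
    (hlo : 2 * M ≤ M') (hhi : M' ≤ 4 * M)
    (h : ω ∈ zdFourArmOutLanded n M ∩ (outwardOpenEventsTo M M' ∩ outwardDualEventsTo M M')) :
    ω ∈ zdFourArmOutLanded n M' := by
  obtain ⟨⟨⟨⟨A⟩, ⟨B⟩⟩, ⟨⟨T⟩, ⟨D⟩⟩⟩, ⟨⟨hH, ⟨hG₀, ⟨hU₀, hU⟩⟩⟩, ⟨hHL, ⟨hG₀L, ⟨hU₀L, hUL⟩⟩⟩⟩,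
    ⟨⟨hK, ⟨hHd, ⟨hVd, hCd⟩⟩⟩, ⟨hKB, ⟨hHdB, ⟨hVdB, hCdB⟩⟩⟩⟩⟩ := h
  refine ⟨⟨?_, ?_⟩, ⟨?_, ?_⟩⟩
  · obtain ⟨s, y, H, hs, hy, hHs, hHo⟩ := exists_walk_of_mem_lrCrossingAt hω hH
    obtain ⟨s₂, y₂, G₀, hs₂, hy₂, hG₀s, hG₀o⟩ := exists_walk_of_mem_lrCrossingAt hω hG₀
    obtain ⟨p₂, q₂, U₀, hp₂, hq₂, hU₀s, hU₀o⟩ := exists_walk_of_mem_tbCrossingAt hω hU₀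
    obtain ⟨p₃, q₃, U, hp₃, hq₃, hUs, hUo⟩ := exists_walk_of_mem_tbCrossingAt hω hU
    simp only [Matrix.cons_val_zero, Matrix.cons_val_one] at hs hy hHs hs₂ hy₂ hG₀s
    simp only [Matrix.cons_val_zero, Matrix.cons_val_one] at hp₂ hq₂ hU₀s hp₃ hq₃ hUs
    exact A.outwardTo hM h2 hlo hhi H hs (by omega)
      (fun v hv => by have h := hHs v hv; exact ⟨by omega, by omega, by omega, by omega⟩) hHo
      G₀ hs₂ (by omega) (fun v hv => by have h := hG₀s v hv; exact ⟨by omega, by omega, by omega, by omega⟩) hG₀o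
      U₀ hp₂ (by omega) (fun v hv => by have h := hU₀s v hv; exact ⟨by omega, by omega, by omega, by omega⟩) hU₀o
      U hp₃ (by omega) (fun v hv => by have h := hUs v hv; exact ⟨by omega, by omega, by omega, by omega⟩) hUo
  · obtain ⟨s, y, H, hs, hy, hHs, hHo⟩ := exists_walk_of_mem_lrCrossingAt hω hHL
    obtain ⟨s₂, y₂, G₀, hs₂, hy₂, hG₀s, hG₀o⟩ := exists_walk_of_mem_lrCrossingAt hω hG₀L
    obtain ⟨p₂, q₂, U₀, hp₂, hq₂, hU₀s, hU₀o⟩ := exists_walk_of_mem_tbCrossingAt hω hU₀L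
    obtain ⟨p₃, q₃, U, hp₃, hq₃, hUs, hUo⟩ := exists_walk_of_mem_tbCrossingAt hω hUL
    simp only [Matrix.cons_val_zero, Matrix.cons_val_one] at hs hy hHs hs₂ hy₂ hG₀s
    simp only [Matrix.cons_val_zero, Matrix.cons_val_one] at hp₂ hq₂ hU₀s hp₃ hq₃ hUs
    exact B.outwardTo hM h2 hlo hhi H.reverse (by omega) (by omega)
      (fun v hv => by
        rw [Walk.support_reverse, List.mem_reverse] at hv
        have h := hHs v hv; exact ⟨by omega, by omega, by omega, by omega⟩)
      (fun e he => hHo e (by rwa [Walk.edges_reverse, List.mem_reverse] at he))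
      G₀.reverse (by omega) (by omega)
      (fun v hv => by
        rw [Walk.support_reverse, List.mem_reverse] at hv
        have h := hG₀s v hv; exact ⟨by omega, by omega, by omega, by omega⟩)
      (fun e he => hG₀o e (by rwa [Walk.edges_reverse, List.mem_reverse] at he))
      U₀ hp₂ (by omega) (fun v hv => by have h := hU₀s v hv; exact ⟨by omega, by omega, by omega, by omega⟩) hU₀o
      U hp₃ (by omega) (fun v hv => by have h := hUs v hv; exact ⟨by omega, by omega, by omega, by omega⟩) hUo
  · obtain ⟨ka, kb, K, hka, hkb, hKs, hKc⟩ := hK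
    obtain ⟨xa, xb, Hd, hxa, hxb, hHds, hHdc⟩ := hHd
    obtain ⟨va, vb, Vd, hva, hvb, hVds, hVdc⟩ := hVd
    obtain ⟨ya, yb, Cd, hya, hyb, hCds, hCdc⟩ := hCd
    simp only [Matrix.cons_val_zero, Matrix.cons_val_one] at hka hkb hKs hxa hxb hHds
    simp only [Matrix.cons_val_zero, Matrix.cons_val_one] at hva hvb hVds hya hyb hCds
    exact T.outwardTo hM h2 hlo hhi K (by omega) (by omega)
      (fun f hf => by have h := hKs f hf; exact ⟨by omega, by omega, by omega, by omega⟩) hKc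
      Hd hxa (by omega) (fun f hf => by have h := hHds f hf; exact ⟨by omega, by omega, by omega, by omega⟩) hHdc
      Vd (by omega) (by omega) (fun f hf => by have h := hVds f hf; exact ⟨by omega, by omega, by omega, by omega⟩) hVdc
      Cd hya (by omega) (fun f hf => by have h := hCds f hf; exact ⟨by omega, by omega, by omega, by omega⟩) hCdc
  · obtain ⟨ka, kb, K, hka, hkb, hKs, hKc⟩ := hKB
    obtain ⟨xa, xb, Hd, hxa, hxb, hHds, hHdc⟩ := hHdB
    obtain ⟨va, vb, Vd, hva, hvb, hVds, hVdc⟩ := hVdB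
    obtain ⟨ya, yb, Cd, hya, hyb, hCds, hCdc⟩ := hCdB
    simp only [Matrix.cons_val_zero, Matrix.cons_val_one] at hka hkb hKs hxa hxb hHds
    simp only [Matrix.cons_val_zero, Matrix.cons_val_one] at hva hvb hVds hya hyb hCds
    exact D.outwardTo hM h2 hlo hhi K (by omega) (by omega)
      (fun f hf => by have h := hKs f hf; exact ⟨by omega, by omega, by omega, by omega⟩) hKc
      Hd hxa (by omega) (fun f hf => by have h := hHds f hf; exact ⟨by omega, by omega, by omega, by omega⟩) hHdc
      Vd (by omega) (by omega) (fun f hf => by have h := hVds f hf; exact ⟨by omega, by omega, by omega, by omega⟩) hVdc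
      Cd hya (by omega) (fun f hf => by have h := hCds f hf; exact ⟨by omega, by omega, by omega, by omega⟩) hCdc

/-- **The eight open events** of the outward extension from `M` to `2M`: for the right arm the
corridor `[M+1, 2M] × [0, M/64]` (left–right) and the three outer crossings of
`exists_outwardFence_R` at the scale `2M`; mirror images for the left arm. [cite: Nolin2008, §4.3 Prop. 12 (i) (arXiv 0711.4948: Prop. 11 (i))] -/
def outwardOpenEvents (M : ℕ) : Set (BondConfig (Site 2)) :=
  (lrCrossingAt ![(M : ℤ) + 1, 0] (M - 1) (M / 64) ∩
    (lrCrossingAt ![((2 * M : ℕ) : ℤ) - ((2 * M) / 16 : ℕ), 0] ((2 * M) / 16 + (2 * M) / 8 - 1) ((2 * M) / 64) ∩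
      (tbCrossingAt' ![((2 * M : ℕ) : ℤ) - ((2 * M) / 16 : ℕ), -(((2 * M) / 64 : ℕ) : ℤ)] ((2 * M) / 16 - 1)
          (3 * ((2 * M) / 64)) ∩
        tbCrossingAt' ![((2 * M : ℕ) : ℤ) + 1, -(((2 * M) / 64 : ℕ) : ℤ)] ((2 * M) / 8 - 2) (3 * ((2 * M) / 64))))) ∩
  (lrCrossingAt ![-((2 * M : ℕ) : ℤ), 0] (M - 1) (M / 64) ∩
    (lrCrossingAt ![-((2 * M : ℕ) : ℤ) - ((2 * M) / 8 : ℕ) + 1, 0] ((2 * M) / 16 + (2 * M) / 8 - 1) ((2 * M) / 64) ∩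
      (tbCrossingAt' ![-((2 * M : ℕ) : ℤ) + 1, -(((2 * M) / 64 : ℕ) : ℤ)] ((2 * M) / 16 - 1) (3 * ((2 * M) / 64)) ∩
        tbCrossingAt' ![-((2 * M : ℕ) : ℤ) - ((2 * M) / 8 : ℕ) + 1, -(((2 * M) / 64 : ℕ) : ℤ)] ((2 * M) / 8 - 2)
          (3 * ((2 * M) / 64)))))

/-- **The eight closed-dual events** of the outward extension: for the top dual arm the face corridor
`[0, M/64] × [M+1, 2M]` (top–bottom) and the three outer face crossings of `exists_outwardFence_T` at
the scale `2M`; mirror images for the bottom dual arm. [cite: Nolin2008, §4.3 Prop. 12 (i) (arXiv 0711.4948: Prop. 11 (i))] -/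
def outwardDualEvents (M : ℕ) : Set (BondConfig (Site 2)) :=
  (dualFaceCrossing ![0, (M : ℤ) + 2] (M / 64 + 1) (M - 2) ∩
    (dualLRFaceCrossing ![-(((2 * M) / 64 : ℕ) : ℤ), ((2 * M : ℕ) : ℤ) - ((2 * M) / 16 : ℕ) + 1] (3 * ((2 * M) / 64))
        ((2 * M) / 16 - 2) ∩
      (dualFaceCrossing ![0, ((2 * M : ℕ) : ℤ) - ((2 * M) / 16 : ℕ) + 2] ((2 * M) / 64 + 1)
          ((2 * M) / 16 + (2 * M) / 8 - 3) ∩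
        dualLRFaceCrossing ![-(((2 * M) / 64 : ℕ) : ℤ), ((2 * M : ℕ) : ℤ) + 1] (3 * ((2 * M) / 64)) ((2 * M) / 8 - 2)))) ∩
  (dualFaceCrossing ![0, -((2 * M : ℕ) : ℤ)] (M / 64 + 1) (M - 2) ∩
    (dualLRFaceCrossing ![-(((2 * M) / 64 : ℕ) : ℤ), -((2 * M : ℕ) : ℤ)] (3 * ((2 * M) / 64)) ((2 * M) / 16 - 2) ∩
      (dualFaceCrossing ![0, -((2 * M : ℕ) : ℤ) - ((2 * M) / 8 : ℕ) + 1] ((2 * M) / 64 + 1)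
          ((2 * M) / 16 + (2 * M) / 8 - 3) ∩
        dualLRFaceCrossing ![-(((2 * M) / 64 : ℕ) : ℤ), -((2 * M : ℕ) : ℤ) - ((2 * M) / 8 : ℕ)] (3 * ((2 * M) / 64))
          ((2 * M) / 8 - 2))))

/-- `outwardOpenEvents M` is `outwardOpenEventsTo M (2M)`. [folklore] -/
theorem outwardOpenEventsTo_two_mul (M : ℕ) : outwardOpenEventsTo M (2 * M) = outwardOpenEvents M := by
  unfold outwardOpenEventsTo outwardOpenEvents
  rw [show 2 * M - M - 1 = M - 1 by omega]

/-- `outwardDualEvents M` is `outwardDualEventsTo M (2M)`. [folklore] -/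
theorem outwardDualEventsTo_two_mul (M : ℕ) : outwardDualEventsTo M (2 * M) = outwardDualEvents M := by
  unfold outwardDualEventsTo outwardDualEvents
  rw [show 2 * M - M - 2 = M - 2 by omega]

/-- **Outward extension from `M` to `2M`, deterministic half**:
`zdFourArmOutLanded n M ∩ outwardOpenEvents M ∩ outwardDualEvents M ⊆ zdFourArmOutLanded n (2M)` on
lattice configurations (`64 ≤ M`, `2n ≤ M`). [cite: Nolin2008, §4.3 Prop. 12 (i) and §4.4 proof of Thm. 11 (arXiv 0711.4948: Prop. 11 (i); Thm. 10, p. 12)] [cite: KestenScalingCMP1987, §2 Lemma 4] -/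
theorem mem_zdFourArmOutLanded_of_mem_outward (hω : ω ⊆ (zdGraph 2).edgeSet) (hM : 64 ≤ M) (h2 : 2 * n ≤ M)
    (h : ω ∈ zdFourArmOutLanded n M ∩ (outwardOpenEvents M ∩ outwardDualEvents M)) :
    ω ∈ zdFourArmOutLanded n (2 * M) := by
  rw [← outwardOpenEventsTo_two_mul, ← outwardDualEventsTo_two_mul] at h
  exact mem_zdFourArmOutLanded_of_mem_outwardTo hω hM h2 le_rfl (by omega) h

end Events

end Literature.Probability.Percolation

end
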